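import Mathlib.NumberTheory.LucasPrimality
import Mathlib.Tactic.ReduceModChar
import Mathlib.Tactic.NormNum.Prime
import HarnessLib

/-!
# Crux `GordTwoRankZeroOffCaseOne` (item 19357): two folklore helpers for PRATT CERTIFICATES (primality of the large
# level-raising primes of companion partners found outside the tables) — TOOL, theorems only

Cell `bsd-addord`, seat `bsd-addord-k1-c2` (D-0074 row B1), gen 5. HONEST FRAMING: nothing here concerns the
Birch–Swinnerton-Dyer conjecture directly; this is a TOOL file (two one-line lemmas, no definition, no named fact,
no `sorry`); nothing booked.

## Why

The per-pair companion / visibility records of this seat (`…CompanionRecord<label>.lean`) whose partner `F` comes from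
Fisher's Hesse pencils `X_E(5)` / `X_E⁻(5)` (conductor `> 5·10⁵`) must certify IN THE KERNEL that the prime list `L`
supporting `Δ_E Δ_F` consists of primes (`hLp`, Kraus' factored minimality criterion, the `Fact (Nat.Prime ℓ)` instances
of the local deciders). `norm_num`'s primality test is unusable above `~2^25`; the level-raising primes of such partners
have `8–30` digits. The tree's precedent (`Literature/Algebra/Polynomial/CasasAlvero/Degree6CandidatesPrime.lean`) proves
such primalities by Pratt certificates — Lucas' converse of Fermat (`lucas_primality`, Mathlib) with the modular powers
evaluated by `reduce_mod_char` — using two PRIVATE helpers; this file re-states them publicly (same one-line proofs) so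
that generated records can cite them.

* `pratt_zmod_natCast_ne_one` — in `ZMod n`, the cast of `c` is not `1` when `c % n ≠ 1` (`1 < n`).
* `pratt_mem_of_prime_dvd` — a prime dividing `n ∣ (∏ L)^k` (all members of `L` prime) is a member of `L`.

References: Pratt 1975 (every prime has a succinct certificate) [folklore]; Mathlib `lucas_primality`.
-/

set_option autoImplicit false

namespace Summit.BirchSwinnertonDyer.BirchSwinnertonDyer.Theorems.AdditiveBranchIMCGordTwoRankZeroCompanion

/-- In `ZMod n` (`1 < n`), the cast of a natural number `c` with `c % n ≠ 1` is not `1`. [folklore] -/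
theorem pratt_zmod_natCast_ne_one {n c : ℕ} (hn : 1 < n) (hc : c % n ≠ 1) : ((c : ℕ) : ZMod n) ≠ 1 := by
  intro h
  haveI : Fact (1 < n) := ⟨hn⟩
  apply hc
  have := congrArg ZMod.val h
  rwa [ZMod.val_natCast, ZMod.val_one] at this

/-- If a prime `q` divides `n` and `n` divides a power of the product of a list of primes, then `q` is in the list
(the "complete factorisation of `p − 1`" step of a Pratt certificate). [folklore] -/
theorem pratt_mem_of_prime_dvd {q n : ℕ} (hq : q.Prime) (L : List ℕ) (hL : ∀ r ∈ L, r.Prime) {k : ℕ}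
    (hn : n ∣ L.prod ^ k) (hqn : q ∣ n) : q ∈ L := by
  have h : q ∣ L.prod := hq.dvd_of_dvd_pow (hqn.trans hn)
  clear hn hqn
  induction L with
  | nil => exact absurd h (by simpa using hq.one_lt.ne')
  | cons r L ih =>
      rw [List.prod_cons] at h
      rcases (Nat.Prime.dvd_mul hq).mp h with hr | hL'
      · exact List.mem_cons.mpr (Or.inl ((Nat.prime_dvd_prime_iff_eq hq (hL r (by simp))).mp hr))
      · exact List.mem_cons_of_mem _ (ih (fun s hs => hL s (by simp [hs])) hL')

end Summit.BirchSwinnertonDyer.BirchSwinnertonDyer.Theorems.AdditiveBranchIMCGordTwoRankZeroCompanion
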